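import Summits.RiemannHypothesis.RiemannHypothesis.Theorems.SemilocalNegCertUptoHundredThirtyNineKinkedPieces
import Summits.RiemannHypothesis.RiemannHypothesis.Theorems.SemilocalNegCertUptoHundredThirtyNineKinkedAtoms
import Summits.RiemannHypothesis.RiemannHypothesis.Theorems.SemilocalTwoThreeLower8046
import HarnessLib

/-!
# Semi-local threshold of the `{∞} ∪ {p < 149}` form, negative side: `a*({2,…,139}) ≤ 321/128` — the wall `q = 149` from a KINKED (piecewise-cubic) witness (part 18/18: the theorems)

Cell `rh-explicit` (HOME `run/shared/lean/pub/rh-explicit/`), seat cc-s2-4 (A4 SEMILOCAL-TABLE, kernel column; pipeline gen11 `mkkinked.py`).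
Honest framing: theorems about the tree's `weilSemilocalThreshold S`; nothing here bears on RH.  No data is trusted: every bound is a
`decide +kernel` fact of the piecewise certificate `SemilocalPiecewiseCert.lean` (cc-s2-4 gen8).

Instance: `S = {p < 149}`, window `b = 321/128` (last /1024 value below `(log 151)/2`), `N = 150`, 47 atoms; odd piecewise-cubic
witness with 24 slope breaks at the atom images `|b − log n|` nearest `0` (atoms `n = 13, 11, 16, 9, 17, 8, 19, 7, 23, 25, 27, 29, 5, 31, 32, 37, 4, 41, 43, 47, 49, 3, 53, 59`,
rounded to `/1024`); float finder `Re Q/‖G‖² = -1.416e-04` (no polar credit); orders `(10, 4, 8, 4, 10, 40)`, 605 `t`-pieces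
(far widths ≤ 1/4); exact kernel margin `(rhs − lhs)/‖G‖² = 1.4144e-04`.  ⇒ **`a*({p < 149}) ≤ 321/128 < (log 151)/2`**.
The instance is split for the gate into part 1
(table, certificate, `checkMainPW`, the atom side in kernel chunks of ≤ 4 atoms via `SemilocalPiecewiseCertSplit.lean`), parts 2–10
(68 piece facts each in the FLEX layout of `SemilocalPiecewiseCertFlex.lean` (cc-s2-4 gen12, CC4-LEAN §17.2): piece `0` by `checkPiecePW`,
every far piece by `checkPieceFlex i ⟨n, m, K, m', u₀⟩` with the orders that piece needs (mean majorant degree ≈ 62 instead of 176) and a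
short dyadic centre `u₀ ≤ u_K(T₀)` — same witness, same cuts, claims recomputed (`⌈exact⌉ + 1`), kernel margin `1.4142e-04`·‖G‖²; each
fact file imports part 1 only), the Pieces part (composition) and the Final part (theorems).  Folklore throughout.
-/

set_option autoImplicit false
set_option linter.dupNamespace false  -- the mandated namespace repeats `RiemannHypothesis`
set_option Elab.async false  -- serialise the kernel facts: in parallel they exhaust the node's per-process heap (cc-s2-4 gen11, CC4-LEAN §16.10)

noncomputable section

open Complex Filter Set MeasureTheory Topology
open scoped Real

namespace Summit.RiemannHypothesis.RiemannHypothesis.Theorems.SemilocalPolyWitness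

open MeasureTheory Set Finset Real
open Literature.NumberTheory.LFunctions
open Summit.RiemannHypothesis.RiemannHypothesis.Theorems.MotivicDoor
open Summit.RiemannHypothesis.RiemannHypothesis.Theorems.MotivicDoor.SemilocalThreshold
open Summit.RiemannHypothesis.RiemannHypothesis.Theorems.MotivicDoor.SemilocalMarkov
open LQ

/-! ### The theorems -/

/-- **`a*({2,…,139}) ≤ 321/128`** — the TWIN-PRIME wall `q = 149` (`q⁺ = 151`), out of reach of the polynomial rows, from a KINKED
(piecewise-cubic) witness with 24 slope breaks at atom images. -/
theorem weilSemilocalThreshold_uptoHundredThirtyNine_le :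
    weilSemilocalThreshold {2, 3, 5, 7, 11, 13, 17, 19, 23, 29, 31, 37, 41, 43, 47, 53, 59, 61, 67, 71, 73, 79, 83, 89, 97, 101, 103, 107, 109, 113, 127, 131, 137, 139} ≤ ((321 / 128 : ℚ) : ℝ) :=
  weilSemilocalThreshold_le_of_checkPW_flex_sharp certUptoHundredThirtyNineKinked atomsEnclose_UptoHundredThirtyNine
    check_UptoHundredThirtyNineKinked_main check_UptoHundredThirtyNineKinked_atoms check_UptoHundredThirtyNineKinked_pieces

/-- Failure form: positivity of the `{∞} ∪ S_{149}` form fails on every cone `C(B)`, `B > 321/128`. -/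
theorem not_weilSemilocalPositivityOn_uptoHundredThirtyNine_of_gt {B : ℝ} (hB : (321 / 128 : ℝ) < B) :
    ¬ WeilSemilocalPositivityOn {2, 3, 5, 7, 11, 13, 17, 19, 23, 29, 31, 37, 41, 43, 47, 53, 59, 61, 67, 71, 73, 79, 83, 89, 97, 101, 103, 107, 109, 113, 127, 131, 137, 139} B := by
  rw [not_weilSemilocalPositivityOn_iff_weilSemilocalThreshold_lt]
  have h := weilSemilocalThreshold_uptoHundredThirtyNine_le
  push_cast at h
  linarith

/-- **`a*({2,…,139}) < (log 151)/2`** — the RH-free upper clause of the handoff programme at the twin-prime wall `q = 149`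
(`151 = q⁺` is the next prime and the window end `N + 1`). -/
theorem weilSemilocalThreshold_uptoHundredThirtyNine_lt_log_hundredfiftyone_half :
    weilSemilocalThreshold {2, 3, 5, 7, 11, 13, 17, 19, 23, 29, 31, 37, 41, 43, 47, 53, 59, 61, 67, 71, 73, 79, 83, 89, 97, 101, 103, 107, 109, 113, 127, 131, 137, 139} < Real.log 151 / 2 := by
  have h := weilSemilocalThreshold_uptoHundredThirtyNine_le
  have hsucc := logHundredFiftyOneLo11_le
  rw [logHundredFiftyOneLo11] at hsucc
  push_cast at h hsucc
  linarith

set_option maxHeartbeats 1000000 in  -- 151-way `interval_cases` with 34-prime membership simps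
/-- **The class `2, …, 139 ∈ S ∌ 149`**: `a*(S) = a*({2,…,139})` (locality at `N = 150`). -/
theorem weilSemilocalThreshold_eq_uptoHundredThirtyNine {S : Finset ℕ} (h2 : 2 ∈ S) (h3 : 3 ∈ S) (h5 : 5 ∈ S) (h7 : 7 ∈ S) (h11 : 11 ∈ S) (h13 : 13 ∈ S) (h17 : 17 ∈ S) (h19 : 19 ∈ S) (h23 : 23 ∈ S) (h29 : 29 ∈ S) (h31 : 31 ∈ S) (h37 : 37 ∈ S) (h41 : 41 ∈ S) (h43 : 43 ∈ S) (h47 : 47 ∈ S) (h53 : 53 ∈ S) (h59 : 59 ∈ S) (h61 : 61 ∈ S) (h67 : 67 ∈ S) (h71 : 71 ∈ S) (h73 : 73 ∈ S) (h79 : 79 ∈ S) (h83 : 83 ∈ S) (h89 : 89 ∈ S) (h97 : 97 ∈ S) (h101 : 101 ∈ S) (h103 : 103 ∈ S) (h107 : 107 ∈ S) (h109 : 109 ∈ S) (h113 : 113 ∈ S) (h127 : 127 ∈ S) (h131 : 131 ∈ S) (h137 : 137 ∈ S) (h139 : 139 ∈ S)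
    (h149 : 149 ∉ S) : weilSemilocalThreshold S = weilSemilocalThreshold {2, 3, 5, 7, 11, 13, 17, 19, 23, 29, 31, 37, 41, 43, 47, 53, 59, 61, 67, 71, 73, 79, 83, 89, 97, 101, 103, 107, 109, 113, 127, 131, 137, 139} := by
  refine weilSemilocalThreshold_congr (S := {2, 3, 5, 7, 11, 13, 17, 19, 23, 29, 31, 37, 41, 43, 47, 53, 59, 61, 67, 71, 73, 79, 83, 89, 97, 101, 103, 107, 109, 113, 127, 131, 137, 139}) (S' := S) (N := 150) ?_ ?_
  · intro n hn hpp
    interval_cases n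
    · exact absurd hpp (by decide)
    · exact absurd hpp (by decide)
    · rw [Nat.prime_two.primeFactors]; simp [h2]
    · rw [Nat.prime_three.primeFactors]; simp [h3]
    · rw [show (4 : ℕ) = 2 ^ 2 by norm_num, Nat.primeFactors_prime_pow two_ne_zero Nat.prime_two]; simp [h2]
    · rw [(by norm_num : Nat.Prime 5).primeFactors]; simp [h5]
    · exact absurd hpp (by decide)
    · rw [(by norm_num : Nat.Prime 7).primeFactors]; simp [h7]
    · rw [show (8 : ℕ) = 2 ^ 3 by norm_num, Nat.primeFactors_prime_pow (by norm_num) Nat.prime_two]; simp [h2]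
    · rw [show (9 : ℕ) = 3 ^ 2 by norm_num, Nat.primeFactors_prime_pow two_ne_zero Nat.prime_three]; simp [h3]
    · exact absurd hpp (by decide)
    · rw [(by norm_num : Nat.Prime 11).primeFactors]; simp [h11]
    · exact absurd hpp (by decide)
    · rw [(by norm_num : Nat.Prime 13).primeFactors]; simp [h13]
    · exact absurd hpp (by decide)
    · exact absurd hpp (not_isPrimePow_of_two_primes_dvd Nat.prime_three (by norm_num : Nat.Prime 5) (by norm_num)
        (by norm_num) (by norm_num))
    · rw [show (16 : ℕ) = 2 ^ 4 by norm_num, Nat.primeFactors_prime_pow (by norm_num) Nat.prime_two]; simp [h2]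
    · rw [(by norm_num : Nat.Prime 17).primeFactors]; simp [h17]
    · exact absurd hpp (by decide)
    · rw [(by norm_num : Nat.Prime 19).primeFactors]; simp [h19]
    · exact absurd hpp (by decide)
    · exact absurd hpp (not_isPrimePow_of_two_primes_dvd Nat.prime_three (by norm_num : Nat.Prime 7) (by norm_num)
        (by norm_num) (by norm_num))
    · exact absurd hpp (by decide)
    · rw [(by norm_num : Nat.Prime 23).primeFactors]; simp [h23]
    · exact absurd hpp (by decide)
    · rw [show (25 : ℕ) = 5 ^ 2 by norm_num, Nat.primeFactors_prime_pow two_ne_zero (by norm_num : Nat.Prime 5)]; simp [h5]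
    · exact absurd hpp (by decide)
    · rw [show (27 : ℕ) = 3 ^ 3 by norm_num, Nat.primeFactors_prime_pow (by norm_num) Nat.prime_three]; simp [h3]
    · exact absurd hpp (by decide)
    · rw [(by norm_num : Nat.Prime 29).primeFactors]; simp [h29]
    · exact absurd hpp (by decide)
    · rw [(by norm_num : Nat.Prime 31).primeFactors]; simp [h31]
    · rw [show (32 : ℕ) = 2 ^ 5 by norm_num, Nat.primeFactors_prime_pow (by norm_num) Nat.prime_two]; simp [h2]
    · exact absurd hpp (not_isPrimePow_of_two_primes_dvd Nat.prime_three (by norm_num : Nat.Prime 11) (by norm_num)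
        (by norm_num) (by norm_num))
    · exact absurd hpp (by decide)
    · exact absurd hpp (not_isPrimePow_of_two_primes_dvd (by norm_num : Nat.Prime 5) (by norm_num : Nat.Prime 7) (by norm_num)
        (by norm_num) (by norm_num))
    · exact absurd hpp (by decide)
    · rw [(by norm_num : Nat.Prime 37).primeFactors]; simp [h37]
    · exact absurd hpp (by decide)
    · exact absurd hpp (not_isPrimePow_of_two_primes_dvd Nat.prime_three (by norm_num : Nat.Prime 13) (by norm_num)
        (by norm_num) (by norm_num))
    · exact absurd hpp (by decide)
    · rw [(by norm_num : Nat.Prime 41).primeFactors]; simp [h41]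
    · exact absurd hpp (by decide)
    · rw [(by norm_num : Nat.Prime 43).primeFactors]; simp [h43]
    · exact absurd hpp (by decide)
    · exact absurd hpp (not_isPrimePow_of_two_primes_dvd Nat.prime_three (by norm_num : Nat.Prime 5) (by norm_num)
        (by norm_num) (by norm_num))
    · exact absurd hpp (by decide)
    · rw [(by norm_num : Nat.Prime 47).primeFactors]; simp [h47]
    · exact absurd hpp (by decide)
    · rw [show (49 : ℕ) = 7 ^ 2 by norm_num, Nat.primeFactors_prime_pow two_ne_zero (by norm_num : Nat.Prime 7)]; simp [h7]
    · exact absurd hpp (by decide)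
    · exact absurd hpp (not_isPrimePow_of_two_primes_dvd Nat.prime_three (by norm_num : Nat.Prime 17) (by norm_num)
        (by norm_num) (by norm_num))
    · exact absurd hpp (by decide)
    · rw [(by norm_num : Nat.Prime 53).primeFactors]; simp [h53]
    · exact absurd hpp (by decide)
    · exact absurd hpp (not_isPrimePow_of_two_primes_dvd (by norm_num : Nat.Prime 5) (by norm_num : Nat.Prime 11) (by norm_num)
        (by norm_num) (by norm_num))
    · exact absurd hpp (by decide)
    · exact absurd hpp (not_isPrimePow_of_two_primes_dvd Nat.prime_three (by norm_num : Nat.Prime 19) (by norm_num)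
        (by norm_num) (by norm_num))
    · exact absurd hpp (by decide)
    · rw [(by norm_num : Nat.Prime 59).primeFactors]; simp [h59]
    · exact absurd hpp (by decide)
    · rw [(by norm_num : Nat.Prime 61).primeFactors]; simp [h61]
    · exact absurd hpp (by decide)
    · exact absurd hpp (not_isPrimePow_of_two_primes_dvd Nat.prime_three (by norm_num : Nat.Prime 7) (by norm_num)
        (by norm_num) (by norm_num))
    · rw [show (64 : ℕ) = 2 ^ 6 by norm_num, Nat.primeFactors_prime_pow (by norm_num) Nat.prime_two]; simp [h2]
    · exact absurd hpp (not_isPrimePow_of_two_primes_dvd (by norm_num : Nat.Prime 5) (by norm_num : Nat.Prime 13) (by norm_num)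
        (by norm_num) (by norm_num))
    · exact absurd hpp (by decide)
    · rw [(by norm_num : Nat.Prime 67).primeFactors]; simp [h67]
    · exact absurd hpp (by decide)
    · exact absurd hpp (not_isPrimePow_of_two_primes_dvd Nat.prime_three (by norm_num : Nat.Prime 23) (by norm_num)
        (by norm_num) (by norm_num))
    · exact absurd hpp (by decide)
    · rw [(by norm_num : Nat.Prime 71).primeFactors]; simp [h71]
    · exact absurd hpp (by decide)
    · rw [(by norm_num : Nat.Prime 73).primeFactors]; simp [h73]
    · exact absurd hpp (by decide)
    · exact absurd hpp (not_isPrimePow_of_two_primes_dvd Nat.prime_three (by norm_num : Nat.Prime 5) (by norm_num)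
        (by norm_num) (by norm_num))
    · exact absurd hpp (by decide)
    · exact absurd hpp (not_isPrimePow_of_two_primes_dvd (by norm_num : Nat.Prime 7) (by norm_num : Nat.Prime 11) (by norm_num)
        (by norm_num) (by norm_num))
    · exact absurd hpp (by decide)
    · rw [(by norm_num : Nat.Prime 79).primeFactors]; simp [h79]
    · exact absurd hpp (by decide)
    · rw [show (81 : ℕ) = 3 ^ 4 by norm_num, Nat.primeFactors_prime_pow (by norm_num) Nat.prime_three]; simp [h3]
    · exact absurd hpp (by decide)
    · rw [(by norm_num : Nat.Prime 83).primeFactors]; simp [h83]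
    · exact absurd hpp (by decide)
    · exact absurd hpp (not_isPrimePow_of_two_primes_dvd (by norm_num : Nat.Prime 5) (by norm_num : Nat.Prime 17) (by norm_num)
        (by norm_num) (by norm_num))
    · exact absurd hpp (by decide)
    · exact absurd hpp (not_isPrimePow_of_two_primes_dvd Nat.prime_three (by norm_num : Nat.Prime 29) (by norm_num)
        (by norm_num) (by norm_num))
    · exact absurd hpp (by decide)
    · rw [(by norm_num : Nat.Prime 89).primeFactors]; simp [h89]
    · exact absurd hpp (by decide)
    · exact absurd hpp (not_isPrimePow_of_two_primes_dvd (by norm_num : Nat.Prime 7) (by norm_num : Nat.Prime 13) (by norm_num)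
        (by norm_num) (by norm_num))
    · exact absurd hpp (by decide)
    · exact absurd hpp (not_isPrimePow_of_two_primes_dvd Nat.prime_three (by norm_num : Nat.Prime 31) (by norm_num)
        (by norm_num) (by norm_num))
    · exact absurd hpp (by decide)
    · exact absurd hpp (not_isPrimePow_of_two_primes_dvd (by norm_num : Nat.Prime 5) (by norm_num : Nat.Prime 19) (by norm_num)
        (by norm_num) (by norm_num))
    · exact absurd hpp (by decide)
    · rw [(by norm_num : Nat.Prime 97).primeFactors]; simp [h97]
    · exact absurd hpp (by decide)
    · exact absurd hpp (not_isPrimePow_of_two_primes_dvd Nat.prime_three (by norm_num : Nat.Prime 11) (by norm_num)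
        (by norm_num) (by norm_num))
    · exact absurd hpp (by decide)
    · rw [(by norm_num : Nat.Prime 101).primeFactors]; simp [h101]
    · exact absurd hpp (by decide)
    · rw [(by norm_num : Nat.Prime 103).primeFactors]; simp [h103]
    · exact absurd hpp (by decide)
    · exact absurd hpp (not_isPrimePow_of_two_primes_dvd Nat.prime_three (by norm_num : Nat.Prime 5) (by norm_num)
        (by norm_num) (by norm_num))
    · exact absurd hpp (by decide)
    · rw [(by norm_num : Nat.Prime 107).primeFactors]; simp [h107]
    · exact absurd hpp (by decide)
    · rw [(by norm_num : Nat.Prime 109).primeFactors]; simp [h109]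
    · exact absurd hpp (by decide)
    · exact absurd hpp (not_isPrimePow_of_two_primes_dvd Nat.prime_three (by norm_num : Nat.Prime 37) (by norm_num)
        (by norm_num) (by norm_num))
    · exact absurd hpp (by decide)
    · rw [(by norm_num : Nat.Prime 113).primeFactors]; simp [h113]
    · exact absurd hpp (by decide)
    · exact absurd hpp (not_isPrimePow_of_two_primes_dvd (by norm_num : Nat.Prime 5) (by norm_num : Nat.Prime 23) (by norm_num)
        (by norm_num) (by norm_num))
    · exact absurd hpp (by decide)
    · exact absurd hpp (not_isPrimePow_of_two_primes_dvd Nat.prime_three (by norm_num : Nat.Prime 13) (by norm_num)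
        (by norm_num) (by norm_num))
    · exact absurd hpp (by decide)
    · exact absurd hpp (not_isPrimePow_of_two_primes_dvd (by norm_num : Nat.Prime 7) (by norm_num : Nat.Prime 17) (by norm_num)
        (by norm_num) (by norm_num))
    · exact absurd hpp (by decide)
    · rw [show (121 : ℕ) = 11 ^ 2 by norm_num, Nat.primeFactors_prime_pow two_ne_zero (by norm_num : Nat.Prime 11)]; simp [h11]
    · exact absurd hpp (by decide)
    · exact absurd hpp (not_isPrimePow_of_two_primes_dvd Nat.prime_three (by norm_num : Nat.Prime 41) (by norm_num)
        (by norm_num) (by norm_num))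
    · exact absurd hpp (by decide)
    · rw [show (125 : ℕ) = 5 ^ 3 by norm_num, Nat.primeFactors_prime_pow (by norm_num) (by norm_num : Nat.Prime 5)]; simp [h5]
    · exact absurd hpp (by decide)
    · rw [(by norm_num : Nat.Prime 127).primeFactors]; simp [h127]
    · rw [show (128 : ℕ) = 2 ^ 7 by norm_num, Nat.primeFactors_prime_pow (by norm_num) Nat.prime_two]; simp [h2]
    · exact absurd hpp (not_isPrimePow_of_two_primes_dvd Nat.prime_three (by norm_num : Nat.Prime 43) (by norm_num)
        (by norm_num) (by norm_num))
    · exact absurd hpp (by decide)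
    · rw [(by norm_num : Nat.Prime 131).primeFactors]; simp [h131]
    · exact absurd hpp (by decide)
    · exact absurd hpp (not_isPrimePow_of_two_primes_dvd (by norm_num : Nat.Prime 7) (by norm_num : Nat.Prime 19) (by norm_num)
        (by norm_num) (by norm_num))
    · exact absurd hpp (by decide)
    · exact absurd hpp (not_isPrimePow_of_two_primes_dvd Nat.prime_three (by norm_num : Nat.Prime 5) (by norm_num)
        (by norm_num) (by norm_num))
    · exact absurd hpp (by decide)
    · rw [(by norm_num : Nat.Prime 137).primeFactors]; simp [h137]
    · exact absurd hpp (by decide)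
    · rw [(by norm_num : Nat.Prime 139).primeFactors]; simp [h139]
    · exact absurd hpp (by decide)
    · exact absurd hpp (not_isPrimePow_of_two_primes_dvd Nat.prime_three (by norm_num : Nat.Prime 47) (by norm_num)
        (by norm_num) (by norm_num))
    · exact absurd hpp (by decide)
    · exact absurd hpp (not_isPrimePow_of_two_primes_dvd (by norm_num : Nat.Prime 11) (by norm_num : Nat.Prime 13) (by norm_num)
        (by norm_num) (by norm_num))
    · exact absurd hpp (by decide)
    · exact absurd hpp (not_isPrimePow_of_two_primes_dvd (by norm_num : Nat.Prime 5) (by norm_num : Nat.Prime 29) (by norm_num)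
        (by norm_num) (by norm_num))
    · exact absurd hpp (by decide)
    · exact absurd hpp (not_isPrimePow_of_two_primes_dvd Nat.prime_three (by norm_num : Nat.Prime 7) (by norm_num)
        (by norm_num) (by norm_num))
    · exact absurd hpp (by decide)
    · rw [(by norm_num : Nat.Prime 149).primeFactors]; simp [h149]
    · exact absurd hpp (by decide)
  · have h := weilSemilocalThreshold_uptoHundredThirtyNine_lt_log_hundredfiftyone_half
    norm_num
    exact h

/-- **`a*(S) ≤ 321/128` for every finite set of primes `S` with `2, …, 139 ∈ S`, `149 ∉ S`.** -/
theorem weilSemilocalThreshold_le_of_mem_hundredthirtynine {S : Finset ℕ} (h2 : 2 ∈ S) (h3 : 3 ∈ S) (h5 : 5 ∈ S) (h7 : 7 ∈ S) (h11 : 11 ∈ S) (h13 : 13 ∈ S) (h17 : 17 ∈ S) (h19 : 19 ∈ S) (h23 : 23 ∈ S) (h29 : 29 ∈ S) (h31 : 31 ∈ S) (h37 : 37 ∈ S) (h41 : 41 ∈ S) (h43 : 43 ∈ S) (h47 : 47 ∈ S) (h53 : 53 ∈ S) (h59 : 59 ∈ S) (h61 : 61 ∈ S) (h67 : 67 ∈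 S) (h71 : 71 ∈ S) (h73 : 73 ∈ S) (h79 : 79 ∈ S) (h83 : 83 ∈ S) (h89 : 89 ∈ S) (h97 : 97 ∈ S) (h101 : 101 ∈ S) (h103 : 103 ∈ S) (h107 : 107 ∈ S) (h109 : 109 ∈ S) (h113 : 113 ∈ S) (h127 : 127 ∈ S) (h131 : 131 ∈ S) (h137 : 137 ∈ S) (h139 : 139 ∈ S)
    (h149 : 149 ∉ S) : weilSemilocalThreshold S ≤ ((321 / 128 : ℚ) : ℝ) := by
  rw [weilSemilocalThreshold_eq_uptoHundredThirtyNine h2 h3 h5 h7 h11 h13 h17 h19 h23 h29 h31 h37 h41 h43 h47 h53 h59 h61 h67 h71 h73 h79 h83 h89 h97 h101 h103 h107 h109 h113 h127 h131 h137 h139 h149]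
  exact weilSemilocalThreshold_uptoHundredThirtyNine_le

/-- **The bracket of the class `2, …, 139 ∈ S ∌ 149`**: `4023/5000 ≤ a*(S) ≤ 321/128`. -/
theorem weilSemilocalThreshold_mem_Icc_of_mem_hundredthirtynine {S : Finset ℕ} (h2 : 2 ∈ S) (h3 : 3 ∈ S) (h5 : 5 ∈ S) (h7 : 7 ∈ S) (h11 : 11 ∈ S) (h13 : 13 ∈ S) (h17 : 17 ∈ S) (h19 : 19 ∈ S) (h23 : 23 ∈ S) (h29 : 29 ∈ S) (h31 : 31 ∈ S) (h37 : 37 ∈ S) (h41 : 41 ∈ S) (h43 : 43 ∈ S) (h47 : 47 ∈ S) (h53 : 53 ∈ S) (h59 : 59 ∈ S) (h61 : 61 ∈ S) (h67 : 67 ∈ S) (h71 : 71 ∈ S) (h73 : 73 ∈ S) (h79 : 79 ∈ S) (h83 : 83 ∈ S) (h89 : 89 ∈ S) (h97 : 97 ∈ S) (h101 : 101 ∈ S) (h103 : 103 ∈ S) (h107 : 107 ∈ S) (h109 : 109 ∈ S) (h113 : 113 ∈ S) (h127 : 127 ∈ S) (h131 : 131 ∈ S) (h137 : 137 ∈ S)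 (h139 : 139 ∈ S)
    (h149 : 149 ∉ S) : weilSemilocalThreshold S ∈ Set.Icc (4023 / 5000 : ℝ) ((321 / 128 : ℚ) : ℝ) :=
  ⟨SemilocalTwoThree.le_weilSemilocalThreshold_of_two_three_8046 h2 h3,
    weilSemilocalThreshold_le_of_mem_hundredthirtynine h2 h3 h5 h7 h11 h13 h17 h19 h23 h29 h31 h37 h41 h43 h47 h53 h59 h61 h67 h71 h73 h79 h83 h89 h97 h101 h103 h107 h109 h113 h127 h131 h137 h139 h149⟩

/-- **The wall offset at the twin-prime wall**: `δ*(149) = a*(S_{149}) − (log 149)/2 ≤ 321/128 − (log 149)/2 < 0.00585`. -/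
theorem weilSemilocalThreshold_uptoHundredThirtyNine_sub_log_half_lt :
    weilSemilocalThreshold {2, 3, 5, 7, 11, 13, 17, 19, 23, 29, 31, 37, 41, 43, 47, 53, 59, 61, 67, 71, 73, 79, 83, 89, 97, 101, 103, 107, 109, 113, 127, 131, 137, 139} - Real.log 149 / 2 < 0.00585 := by
  have h := weilSemilocalThreshold_uptoHundredThirtyNine_le
  have hq := log_hundredfortynine_gt
  push_cast at h
  linarith

end Summit.RiemannHypothesis.RiemannHypothesis.Theorems.SemilocalPolyWitness

end
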